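import Summits.AtomisticToContinuum.Crystallization.Theorems.TornFree.Negative.TolFamily

/-!
# `TornFree` (stmt-AtomisticToContinuum-18069), negative side: monotonicity of the tolerance family

`TolFamily.lean` defines `TornFreeTol τ γ` (the crux is the member `(1/50, 63/50)` by `Iff.rfl`).
This file records the ORDER STRUCTURE of the family, used to propagate refutations of members:
a larger tolerance `τ' ≥ τ` and a smaller gap ratio `γ' ≤ γ` give a WEAKER hypothesis with the SAME
bond graph (as long as the window stays below the gap, `1 + τ' < γ`), hence a stronger statement:
`TornFreeTol τ' γ' → TornFreeTol τ γ` (`tornFreeTol_mono`).  Contrapositively a periodic torn witness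
at `(τ₀, γ₀)` refutes every member with `τ ≥ τ₀`, `γ ≤ γ₀`, `1 + τ < γ₀` (`not_tornFreeTol_of_le`), and
the crux itself is refuted by any witness with `τ₀ ≤ 1/50`, `63/50 ≤ γ₀` (`not_tornFree_of_witness_quadrant`).
Hypothesis-analysis bookkeeping of the Negative/ lane (refuter seat
refuter-cdisprove-stmt-AtomisticToContinuum-18069-g2-0, 2026-08-17); no route item is concluded positively.
-/

noncomputable section

namespace Summit.AtomisticToContinuum.Crystallization.Theorems.TornFree.Negative

open Literature.Geometry.DiscreteGeometry

/-- At a site that is gapped-twelve at `(τ, γ)`, enlarging the bond threshold from `a(1+τ)` to any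
`a(1+τ')` below the gap radius `aγ` does not change which points are bonded. -/
theorem bonded_iff_of_gapped {τ τ' γ : ℝ} {Y : Set (EuclideanSpace ℝ (Fin 3))} {a : ℝ}
    {y : EuclideanSpace ℝ (Fin 3)} (ha : 0 < a) (hτ : τ ≤ τ') (hgap : 1 + τ' < γ)
    (hy : GappedTwelveAt τ γ Y a y) {w : EuclideanSpace ℝ (Fin 3)} (hw : w ∈ Y) (hwy : w ≠ y) :
    dist y w ≤ a * (1 + τ') ↔ dist y w ≤ a * (1 + τ) := by
  constructor
  · intro h
    rcases (hy.2 w hw hwy).2 with h1 | h1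
    · exact h1
    · exfalso
      have : a * (1 + τ') < a * γ := mul_lt_mul_of_pos_left hgap ha
      linarith
  · intro h
    have : a * (1 + τ) ≤ a * (1 + τ') := mul_le_mul_of_nonneg_left (by linarith) ha.le
    linarith

/-- A site gapped-twelve at `(τ, γ)` is gapped-twelve at `(τ', γ')` for `τ ≤ τ'`, `γ' ≤ γ`,
`1 + τ' < γ` (weaker hypothesis). -/
theorem gappedTwelveAt_mono {τ τ' γ γ' : ℝ} {Y : Set (EuclideanSpace ℝ (Fin 3))} {a : ℝ}
    {y : EuclideanSpace ℝ (Fin 3)} (ha : 0 < a) (hτ : τ ≤ τ') (hγ : γ' ≤ γ) (hgap : 1 + τ' < γ)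
    (hy : GappedTwelveAt τ γ Y a y) : GappedTwelveAt τ' γ' Y a y := by
  refine ⟨?_, ?_⟩
  · have hset : {w ∈ Y | w ≠ y ∧ dist y w ≤ a * (1 + τ')} = {w ∈ Y | w ≠ y ∧ dist y w ≤ a * (1 + τ)} := by
      ext w
      simp only [Set.mem_setOf_eq]
      constructor
      · rintro ⟨hw, hwy, hd⟩
        exact ⟨hw, hwy, (bonded_iff_of_gapped ha hτ hgap hy hw hwy).1 hd⟩
      · rintro ⟨hw, hwy, hd⟩
        exact ⟨hw, hwy, (bonded_iff_of_gapped ha hτ hgap hy hw hwy).2 hd⟩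
    rw [hset]
    exact hy.1
  · intro w hw hwy
    obtain ⟨hlo, hdich⟩ := hy.2 w hw hwy
    refine ⟨?_, ?_⟩
    · have : a * (1 - τ') ≤ a * (1 - τ) := mul_le_mul_of_nonneg_left (by linarith) ha.le
      linarith
    · rcases hdich with h | h
      · left
        have : a * (1 + τ) ≤ a * (1 + τ') := mul_le_mul_of_nonneg_left (by linarith) ha.le
        linarith
      · right
        have : a * γ' ≤ a * γ := mul_le_mul_of_nonneg_left hγ ha.le
        linarith

/-- **Monotonicity of the family.**  Larger tolerance and smaller gap ratio (window below the gap)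
make `TornFreeTol` a stronger statement. [folklore] -/
theorem tornFreeTol_mono {τ τ' γ γ' : ℝ} (hτ : τ ≤ τ') (hγ : γ' ≤ γ) (hgap : 1 + τ' < γ) :
    TornFreeTol τ' γ' → TornFreeTol τ γ := by
  intro h Y a ha hall y hy v hv hvy hd
  have hall' : ∀ z ∈ Y, GappedTwelveAt τ' γ' Y a z :=
    fun z hz => gappedTwelveAt_mono ha hτ hγ hgap (hall z hz)
  have hd' : dist y v ≤ a * (1 + τ') := by
    have : a * (1 + τ) ≤ a * (1 + τ') := mul_le_mul_of_nonneg_left (by linarith) ha.le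
    linarith
  have h4 := h Y a ha hall' y hy v hv hvy hd'
  have hset : commons τ' Y a y v = commons τ Y a y v := by
    ext w
    simp only [commons, Set.mem_setOf_eq]
    constructor
    · rintro ⟨hw, hwy, hwv, h1, h2⟩
      exact ⟨hw, hwy, hwv, (bonded_iff_of_gapped ha hτ hgap (hall y hy) hw hwy).1 h1,
        (bonded_iff_of_gapped ha hτ hgap (hall v hv) hw hwv).1 h2⟩
    · rintro ⟨hw, hwy, hwv, h1, h2⟩
      exact ⟨hw, hwy, hwv, (bonded_iff_of_gapped ha hτ hgap (hall y hy) hw hwy).2 h1,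
        (bonded_iff_of_gapped ha hτ hgap (hall v hv) hw hwv).2 h2⟩
  rw [hset] at h4
  exact h4

/-- Propagation of refutations: a refuted member `(τ₀, γ₀)` refutes every member with larger
tolerance and smaller gap ratio whose window stays below `γ₀`. [folklore] -/
theorem not_tornFreeTol_of_le {τ₀ τ γ₀ γ : ℝ} (hτ : τ₀ ≤ τ) (hγ : γ ≤ γ₀) (hgap : 1 + τ < γ₀)
    (h : ¬ TornFreeTol τ₀ γ₀) : ¬ TornFreeTol τ γ :=
  fun h' => h (tornFreeTol_mono hτ hγ hgap h')

/-- The quadrant that would kill the crux: any refuted member with `τ₀ ≤ 1/50` and `63/50 ≤ γ₀`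
refutes `GappedShellCensus.TornFree`. [folklore] -/
theorem not_tornFree_of_witness_quadrant {τ₀ γ₀ : ℝ} (hτ : τ₀ ≤ 1 / 50) (hγ : 63 / 50 ≤ γ₀)
    (h : ¬ TornFreeTol τ₀ γ₀) : ¬ Theses.GappedShellCensus.TornFree := by
  rw [tornFree_iff_tornFreeTol]
  exact not_tornFreeTol_of_le hτ hγ (by linarith) h

end Summit.AtomisticToContinuum.Crystallization.Theorems.TornFree.Negative

end
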